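import Summits.QuantumFields.GaugeBoot.BaryonVertex
import HarnessLib

/-!
# The `N`-leg baryon vertex: the `ε`-contraction of `N` transporters of an `N`-dimensional representation (gauge-boot, L3 negative supplement; SU(N odd) link reflection at `β < 0`, part 1)

HONEST FRAMING (cell `pub-gaugeboot`, page 1 of every file): the venture produces certified bounds
on lattice expectations at stated coupling, gauge group, dimension and torus size; NOT a mass gap,
NOT a continuum limit, NOT a string tension; NOT Yang–Mills-summit-bearing (barriers
`FixedCouplingUltralocality`, `PerturbativeInvisibility`). This module is pure `N × N` matrix algebra
for a NEGATIVE structural result (`FrameLinkRPLayerNet.lean`, `CubicTorusLinkRPNegativeBetaOdd.lean`):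
link (mid-plane) reflection positivity of the Wilson measure FAILS at every `β < 0` for an
`N`-dimensional representation of determinant one with `N` odd (e.g. `SU(N)`, `N` odd, in the
fundamental), as soon as the transverse slice has room for `N` edge-disjoint paths between adjacent
sites (`N ≤ 2d - 3` on the cubic torus).

`BaryonVertex.lean` is the case `N = 3` with an explicit Levi-Civita symbol. Here, for any
commutative ring `R` and any `N`, the **baryon form** of `N` matrices `P₀, …, P_{N-1} ∈ M_N(R)`,

  `B(P) = ∑_{σ, τ ∈ S_N} sgn σ · sgn τ · ∏_a (P_a)_{σ(a) τ(a)}`                  (`baryonForm`)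

(`= ∑ ε_{i_0…i_{N-1}} ε_{j_0…j_{N-1}} ∏_a (P_a)_{i_a j_a}`: two `ε`-tensors contracting `N`
transporters — a baryon at one end, an antibaryon at the other):

* `baryonForm_eq_sum_det_colMixN` / `_rowMixN` — the inner `ε`-contraction is a determinant of
  mixed columns (rows) (`Matrix.det_apply'`);
* `baryonForm_mul_left` / `baryonForm_mul_right` / `baryonForm_conj` — **gauge covariance**
  `B(M P_a) = det M · B(P)`, `B(P_a M) = det M · B(P)`, so `B` is invariant under
  `P_a ↦ g P_a g'` with `det g = det g' = 1` (`Matrix.det_mul`);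
* `baryonForm_one` — `B(1, …, 1) = N!` (the vertex is not identically zero);
* `continuous_baryonForm_comp` — continuity;
* `baryonForm_legMat_eq_sum` — the ENTRY EXPANSION when the legs, indexed by `Option Λ` through a
  bijection `φ : Fin N ≃ Option Λ`, are one single matrix (leg `none`) and triple products
  `M_{(λ,0)} M_{(λ,1)} M_{(λ,2)}` (legs `some λ`): a finite sum `∑_ι starCoef ι · ∏_j (M_j)_{γ_j(ι) δ_j(ι)}`
  over slots `j : Option (Λ × Fin 3)` — the shape in which link variables are integrated out one at
  a time (`MultilinkSlabIntegral.lean`, `LayerNetObservable.lean`).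

Everything is `[folklore]` linear algebra (no representation theory is used).

References: M. Creutz, Quarks, Gluons and Lattices (1983) Ch. 8 (baryon vertices in strong
coupling); K. Osterwalder, E. Seiler, Ann. Phys. 110 (1978) 440, §2.
-/

namespace Summit.QuantumFields.GaugeBoot

namespace Baryon

open Matrix Equiv

variable {R : Type*} [CommRing R] {N : ℕ}

/-! ## Signs -/

/-- The signature of a permutation as a ring element. [folklore] -/
def sgn (σ : Perm (Fin N)) : R := (((Perm.sign σ : ℤˣ) : ℤ) : R)

/-- `sgn σ · sgn σ = 1`. [folklore] -/
theorem sgn_mul_self (σ : Perm (Fin N)) : (sgn σ : R) * sgn σ = 1 := by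
  unfold sgn
  rw [← Int.cast_mul, ← Units.val_mul, Int.units_mul_self, Units.val_one, Int.cast_one]

/-! ## Mixed columns and rows -/

/-- The matrix whose column `a` is column `τ a` of `P a`. [folklore] -/
def colMixN (P : Fin N → Matrix (Fin N) (Fin N) R) (τ : Perm (Fin N)) : Matrix (Fin N) (Fin N) R :=
  Matrix.of fun i a => P a i (τ a)

/-- The matrix whose row `a` is row `σ a` of `P a`. [folklore] -/
def rowMixN (P : Fin N → Matrix (Fin N) (Fin N) R) (σ : Perm (Fin N)) : Matrix (Fin N) (Fin N) R :=
  Matrix.of fun a j => P a (σ a) j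

/-- **The inner `ε`-contraction over first indices is a determinant of mixed columns**:
`∑_σ sgn σ ∏_a (P_a)_{σ a, τ a} = det (colMixN P τ)`. [folklore] -/
theorem sum_sgn_mul_prod_eq_det_colMixN (P : Fin N → Matrix (Fin N) (Fin N) R) (τ : Perm (Fin N)) :
    ∑ σ : Perm (Fin N), sgn σ * ∏ a, P a (σ a) (τ a) = (colMixN P τ).det := by
  rw [Matrix.det_apply']
  refine Finset.sum_congr rfl fun σ _ => ?_
  simp only [sgn, colMixN, Matrix.of_apply]

/-- **The inner `ε`-contraction over second indices is a determinant of mixed rows**: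
`∑_τ sgn τ ∏_a (P_a)_{σ a, τ a} = det (rowMixN P σ)`. [folklore] -/
theorem sum_sgn_mul_prod_eq_det_rowMixN (P : Fin N → Matrix (Fin N) (Fin N) R) (σ : Perm (Fin N)) :
    ∑ τ : Perm (Fin N), sgn τ * ∏ a, P a (σ a) (τ a) = (rowMixN P σ).det := by
  rw [← Matrix.det_transpose, Matrix.det_apply']
  refine Finset.sum_congr rfl fun τ _ => ?_
  simp only [sgn, rowMixN, Matrix.transpose_apply, Matrix.of_apply]

/-- Mixed columns of left-multiplied matrices: `colMixN (M P) τ = M · colMixN P τ`. [folklore] -/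
theorem colMixN_mul_left (M : Matrix (Fin N) (Fin N) R) (P : Fin N → Matrix (Fin N) (Fin N) R)
    (τ : Perm (Fin N)) : colMixN (fun a => M * P a) τ = M * colMixN P τ := by
  ext i a
  simp [colMixN, Matrix.mul_apply]

/-- Mixed rows of right-multiplied matrices: `rowMixN (P M) σ = rowMixN P σ · M`. [folklore] -/
theorem rowMixN_mul_right (M : Matrix (Fin N) (Fin N) R) (P : Fin N → Matrix (Fin N) (Fin N) R)
    (σ : Perm (Fin N)) : rowMixN (fun a => P a * M) σ = rowMixN P σ * M := by
  ext a j
  simp [rowMixN, Matrix.mul_apply]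

/-! ## The baryon form -/

/-- **The baryon form** of `N` transporters of size `N × N`:
`B(P) = ∑_{σ,τ} sgn σ · sgn τ · ∏_a (P_a)_{σ a, τ a}` (two `ε`-tensors). [folklore] -/
def baryonForm (P : Fin N → Matrix (Fin N) (Fin N) R) : R :=
  ∑ σ : Perm (Fin N), ∑ τ : Perm (Fin N), sgn σ * sgn τ * ∏ a, P a (σ a) (τ a)

/-- `B(P) = ∑_τ sgn τ · det (colMixN P τ)`. [folklore] -/
theorem baryonForm_eq_sum_det_colMixN (P : Fin N → Matrix (Fin N) (Fin N) R) :
    baryonForm P = ∑ τ : Perm (Fin N), sgn τ * (colMixN P τ).det := by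
  unfold baryonForm
  rw [Finset.sum_comm]
  refine Finset.sum_congr rfl fun τ _ => ?_
  rw [← sum_sgn_mul_prod_eq_det_colMixN, Finset.mul_sum]
  exact Finset.sum_congr rfl fun σ _ => by ring

/-- `B(P) = ∑_σ sgn σ · det (rowMixN P σ)`. [folklore] -/
theorem baryonForm_eq_sum_det_rowMixN (P : Fin N → Matrix (Fin N) (Fin N) R) :
    baryonForm P = ∑ σ : Perm (Fin N), sgn σ * (rowMixN P σ).det := by
  unfold baryonForm
  refine Finset.sum_congr rfl fun σ _ => ?_
  rw [← sum_sgn_mul_prod_eq_det_rowMixN, Finset.mul_sum]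
  exact Finset.sum_congr rfl fun τ _ => by ring

/-- **Left gauge covariance**: `B(M P₀, …, M P_{N-1}) = det M · B(P)`. [folklore] -/
theorem baryonForm_mul_left (M : Matrix (Fin N) (Fin N) R) (P : Fin N → Matrix (Fin N) (Fin N) R) :
    baryonForm (fun a => M * P a) = M.det * baryonForm P := by
  rw [baryonForm_eq_sum_det_colMixN, baryonForm_eq_sum_det_colMixN, Finset.mul_sum]
  refine Finset.sum_congr rfl fun τ _ => ?_
  rw [colMixN_mul_left, Matrix.det_mul]
  ring

/-- **Right gauge covariance**: `B(P₀ M, …, P_{N-1} M) = det M · B(P)`. [folklore] -/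
theorem baryonForm_mul_right (M : Matrix (Fin N) (Fin N) R) (P : Fin N → Matrix (Fin N) (Fin N) R) :
    baryonForm (fun a => P a * M) = M.det * baryonForm P := by
  rw [baryonForm_eq_sum_det_rowMixN, baryonForm_eq_sum_det_rowMixN, Finset.mul_sum]
  refine Finset.sum_congr rfl fun σ _ => ?_
  rw [rowMixN_mul_right, Matrix.det_mul]
  ring

/-- **Gauge invariance of the baryon form**: for `det g = det g' = 1`,
`B(g P₀ g', …, g P_{N-1} g') = B(P)` — the vertex is an `SL(N)`-invariant. [folklore] -/
theorem baryonForm_conj (g g' : Matrix (Fin N) (Fin N) R) (P : Fin N → Matrix (Fin N) (Fin N) R)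
    (hg : g.det = 1) (hg' : g'.det = 1) : baryonForm (fun a => g * P a * g') = baryonForm P := by
  have h1 : baryonForm (fun a => g * P a * g') = g'.det * baryonForm (fun a => g * P a) :=
    baryonForm_mul_right g' (fun a => g * P a)
  rw [h1, baryonForm_mul_left, hg, hg', one_mul, one_mul]

/-- **`B(1, …, 1) = N!`** (`= ∑_σ (sgn σ)²`): the baryon form does not vanish identically. [folklore] -/
theorem baryonForm_one : baryonForm (fun _ : Fin N => (1 : Matrix (Fin N) (Fin N) R)) = (N.factorial : R) := by
  unfold baryonForm
  have h : ∀ σ τ : Perm (Fin N), ∏ a, (1 : Matrix (Fin N) (Fin N) R) (σ a) (τ a) =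
      if σ = τ then 1 else 0 := by
    intro σ τ
    simp only [Matrix.one_apply]
    rw [Finset.prod_boole]
    by_cases hστ : σ = τ
    · rw [if_pos hστ, if_pos fun a _ => by rw [hστ]]
    · rw [if_neg hστ, if_neg fun hall => hστ (Equiv.ext fun a => hall a (Finset.mem_univ a))]
  simp_rw [h, mul_ite, mul_one, mul_zero, Finset.sum_ite_eq, Finset.mem_univ, if_true, sgn_mul_self]
  rw [Finset.sum_const, Finset.card_univ, Fintype.card_perm, Fintype.card_fin, nsmul_eq_mul, mul_one]

/-- The baryon form of continuous matrix-valued maps is continuous. [folklore] -/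
theorem continuous_baryonForm_comp [TopologicalSpace R] [IsTopologicalRing R] {X : Type*}
    [TopologicalSpace X] {P : X → Fin N → Matrix (Fin N) (Fin N) R}
    (hP : ∀ a, Continuous fun u => P u a) : Continuous fun u => baryonForm (P u) := by
  unfold baryonForm
  refine continuous_finsetSum _ fun σ _ => continuous_finsetSum _ fun τ _ => ?_
  exact continuous_const.mul (continuous_finsetProd _ fun a _ => (hP a).matrix_elem _ _)

/-! ## The entry expansion of a star of legs -/

/-- The legs of a star indexed by `Option Λ`: leg `none` is the single matrix `M none`, leg
`some λ` is the triple product `M (λ,0) · M (λ,1) · M (λ,2)` of its three slot matrices. [folklore] -/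
def legMat {Λ : Type*} (M : Option (Λ × Fin 3) → Matrix (Fin N) (Fin N) R) :
    Option Λ → Matrix (Fin N) (Fin N) R
  | none => M none
  | some l => M (some (l, 0)) * M (some (l, 1)) * M (some (l, 2))

/-- `legMat` on the direct leg. [folklore] -/
@[simp] theorem legMat_none {Λ : Type*} (M : Option (Λ × Fin 3) → Matrix (Fin N) (Fin N) R) :
    legMat M none = M none := rfl

/-- `legMat` on a detour leg. [folklore] -/
@[simp] theorem legMat_some {Λ : Type*} (M : Option (Λ × Fin 3) → Matrix (Fin N) (Fin N) R) (l : Λ) :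
    legMat M (some l) = M (some (l, 0)) * M (some (l, 1)) * M (some (l, 2)) := rfl

/-- The index set of the entry expansion: the two `ε`-permutations and, for every detour leg, the
pair of inner indices of its triple product. [folklore] -/
abbrev StarIdx (N : ℕ) (Λ : Type*) : Type _ := Perm (Fin N) × Perm (Fin N) × (Λ → Fin N × Fin N)

/-- The coefficient `sgn σ · sgn τ` of the entry expansion. [folklore] -/
def starCoef {Λ : Type*} (ι : StarIdx N Λ) : R := sgn ι.1 * sgn ι.2.1

/-- The row index of the entry of the slot matrix `j` in the entry expansion. [folklore] -/
def starRow {Λ : Type*} (φ : Fin N ≃ Option Λ) (ι : StarIdx N Λ) : Option (Λ × Fin 3) → Fin N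
  | none => ι.1 (φ.symm none)
  | some (l, s) => ![ι.1 (φ.symm (some l)), (ι.2.2 l).1, (ι.2.2 l).2] s

/-- The column index of the entry of the slot matrix `j` in the entry expansion. [folklore] -/
def starCol {Λ : Type*} (φ : Fin N ≃ Option Λ) (ι : StarIdx N Λ) : Option (Λ × Fin 3) → Fin N
  | none => ι.2.1 (φ.symm none)
  | some (l, s) => ![(ι.2.2 l).1, (ι.2.2 l).2, ι.2.1 (φ.symm (some l))] s

/-- The entry of a triple product as a sum over the pair of inner indices. [folklore] -/
theorem mul₃_apply (A B C : Matrix (Fin N) (Fin N) R) (r c : Fin N) :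
    (A * B * C) r c = ∑ pq : Fin N × Fin N, A r pq.1 * B pq.1 pq.2 * C pq.2 c := by
  rw [Fintype.sum_prod_type, Finset.sum_comm, Matrix.mul_apply]
  refine Finset.sum_congr rfl fun q _ => ?_
  rw [Matrix.mul_apply, Finset.sum_mul]

/-- **The entry expansion of the baryon form of a star of legs.** For a bijection
`φ : Fin N ≃ Option Λ` between `ε`-indices and legs, and slot matrices `M : Option (Λ × Fin 3) → M_N(R)`,
`B(a ↦ legMat M (φ a)) = ∑_ι starCoef ι · ∏_j (M j)_{starRow φ ι j, starCol φ ι j}`: a finite sum of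
products of ONE entry of each slot matrix. [folklore] -/
theorem baryonForm_legMat_eq_sum {Λ : Type*} [Fintype Λ] [DecidableEq Λ] (φ : Fin N ≃ Option Λ)
    (M : Option (Λ × Fin 3) → Matrix (Fin N) (Fin N) R) :
    baryonForm (fun a => legMat M (φ a)) =
      ∑ ι : StarIdx N Λ, starCoef ι * ∏ j, M j (starRow φ ι j) (starCol φ ι j) := by
  unfold baryonForm
  simp only [Fintype.sum_prod_type]
  refine Finset.sum_congr rfl fun σ _ => Finset.sum_congr rfl fun τ _ => ?_
  rw [Fintype.prod_equiv φ (fun a => legMat M (φ a) (σ a) (τ a))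
    (fun l => legMat M l (σ (φ.symm l)) (τ (φ.symm l))) (fun a => by simp only [Equiv.symm_apply_apply]),
    Fintype.prod_option]
  simp only [legMat_none, legMat_some, mul₃_apply]
  rw [Fintype.prod_sum (fun l (pq : Fin N × Fin N) => M (some (l, 0)) (σ (φ.symm (some l))) pq.1 *
    M (some (l, 1)) pq.1 pq.2 * M (some (l, 2)) pq.2 (τ (φ.symm (some l))))]
  simp only [Finset.mul_sum]
  refine Finset.sum_congr rfl fun PQ _ => ?_
  rw [Fintype.prod_option, Fintype.prod_prod_type]
  simp only [starCoef, starRow, starCol, Fin.prod_univ_three, Matrix.cons_val_zero, Matrix.cons_val_one,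
    Matrix.cons_val_two, Matrix.head_cons, Matrix.tail_cons]

end Baryon

end Summit.QuantumFields.GaugeBoot
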